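import Literature.MathematicalPhysics.QuantumFieldTheory.Balaban1983to89.B9SupplySockB9P3ZdFrame
import Literature.MathematicalPhysics.QuantumFieldTheory.Balaban1983to89.B8Eq138LandauZd

/-!
# `Balaban1983to89.B9SupplySockB9P3ZdLocalLettersOfOps` — [Balaban1985BackgroundPropagators] Thm 3.1∕3.3 (3.42)–(3.47) pp. 397–398 READ AT THE
# `ℤᵈ × 𝔸` FRAME: the LOCAL functionals of `G(U₀)` — n06-e's parameter record `B9SupplySockB9P3ZdFrame.LocalLettersZd` — PINNED TO READINGS OF THE
# OPERATOR LETTER `ops.Gop` (`locOfOpsZd`), so that `B9.Thm33Printed … (GAZdFamOfOps …)` and the Hölder binder `HolderAt(δ)` SAY PRINT'S (3.42)–(3.47)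
# ABOUT THE OPERATOR G(U₀) ITSELF (the junction's `loc` of record, dag-n06-b DESIGN-ANSWER (α), INBOX l.24927)

statement-level skeleton of published theorems with citation tags; proofs where landed; nothing here is a claim about the
Yang–Mills mass gap

PDF held: `paper:balaban1985-cmp99-background-propagators` ([4] = B9; journal page = PDF page + 388), pp. 397–399 (3.39)–(3.47), Thm 3.1, Thm 3.3;
`paper:balaban1985-cmp99-regular-spaces-gauge-fixing` (B8; journal page = PDF page + 74), p. 76 (1.1), p. 86 (1.59).  The displays are quoted verbatim
in `B9.lean` (`Ineq342_346_347`, `Ineq343_345`), `B9SupplySockB9P3ZdFrame` (`geoZd`, `LocalLettersZd`, `globZd`), `B9Eq340HolderZd` ((3.40)) — BY NAME.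

WHAT IS PRINTED (the shapes read here).  (3.42) p. 397: *«|(G′(U)λ)(x)|, |(∇_U G′(U)λ)(x)|, |(G′(U)∇*_U λ)(x)|, |(Δ_U G′(U)λ)(x)| ≤ B₀[(Lʲη)², Lʲη, Lʲη, 1]
e^{−δ₀d(y,y′)}|λ| for x ∈ Δ(y), y ∈ Λ_j, supp λ ⊂ Δ(y′)»*; (3.43) p. 398: *«‖ζ∇_UG′(U)λ‖_β, ‖ζG′(U)∇*_Uλ‖_β ≤ B₀(β₀)(Lʲη)^{1−β}(‖ζ‖_β + |ζ|)e^{−δ₀d(y,y′)}|λ|»*;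
(3.44)–(3.46) the `∇_UG′∇*_U` entry, its Hölder quotient and the six `L²` quantities with cut-off `h`; (3.47) the global weighted entries; Thm 3.3 p. 399:
*«the operator G(U) (a = 1) satisfies the inequalities (3.42)–(3.47), with G′(U) replaced by G(U) and λ replaced by a function J defined at bonds»*.

WHY THIS FILE (cell `pub-ymgap`, HUMAN RULING D-0062 ∕ D-0149; seat `pub-ymgap-dag-n06-w2` (g0), node N06 = [B9]; INTENT-3; count-neutral).  At the concrete
`ℤᵈ` frame of the J-N06→N05 junction the kernel family of G(U₀) is `GAZd 𝔸 L len x ops loc` with the GLOBAL entries (3.47) read off `ops.Gop` (`globZd`)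
but the LOCAL entries `loc : LocalLettersZd 𝔸 L x` a free PARAMETER (n06-e, HONEST SCOPE there: «constructing them is N06's object layer»).  With `loc` free,
the junction's main hypothesis `B9.Thm33Printed c35 (geoZd …) (bgZd …) Gp (GAZdFam … ops loc)` constrains `loc`, not the operator, on its local lines, and the
Hölder binder `HolderAt(δ)` (local (3.43) ⇒ the global Hölder line of B8 (1.59)) cannot be a summation theorem.  dag-n06-b (binder owner) ruled (α): the
readings of `ops.Gop` in `geoZd`'s own conventions ARE the junction's `loc` of record.  This file types them — def-Y's `Node00.OpsYOfLetters.kernelFamilyB`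
pattern on `ℤᵈ` (no unit-ball sup: `geoZd`'s `Loc` is already `𝔸`-valued) — and nothing else.

WHAT IS DECLARED ∕ PROVED (definitions + `rfl` readings + non-negativity; 0 sorry; nothing of [4] asserted).
* §1 letters on bond fields: `cdBZd η U ν J` (forward covariant derivative (1.1)∕(3.3) of every component, `B8Ineq132.covDerivFwd`), `cdsBZd` (backward,
  `covDeriv`), `lapBZd` (componentwise covariant Laplacian `B8Eq138LandauZd.covLap`), `cutMulZd ζ J` (the cut-off «ζ·», «h·» of (3.43)∕(3.46)); `supBlkZd L y Ψ`
  («sup over x ∈ Δ(y)»: the real `iSup` of `‖Ψ(b)‖` over the bonds touching `blockZd L j y`, p. 77 convention — `geoZd`'s `suppIn`).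
* §2 the readings of one letter record `ops` at the member `x`: `eOfOps` ((3.42), four entries), `h1OfOps` ((3.43): the larger of the two Hölder members,
  `B9Eq340HolderZd.holder0` of `ζ·∇_{U,ν}G(U)J` and of `ζ·G(U)∇*_{U,ν}J` at the background `U`), `e4OfOps` ((3.44)), `h2OfOps` ((3.45)), `l2OfOps` ((3.46),
  `l2NormZd`, six entries), `glob2OfOps` ((3.47) n = 2, the shape of `globZd`'s n = 1 with `G∇*` for `∇G`); ★ `locOfOpsZd` (the record); `GAZdOfOps`,
  ★ `GAZdFamOfOps` (the kernel family ∕ family over members with BOTH local and global entries read off `ops.Gop`) + `GAZdFamOfOps_eq` (it IS n06-e's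
  `GAZdFam` at `loc := locOfOpsZd`, `rfl` — so every junction theorem over `GAZdFam … ops loc` applies verbatim).
* §3 readings (`rfl`): `GAZdOfOps_e ∕ _h1 ∕ _e4 ∕ _h2 ∕ _l2 ∕ _glob`; ★ `ineq342_of_GAZdOfOps` — the first clause of `B9.Ineq342_346_347 (GAZdOfOps …) B₀ δ₀ U` READ:
  print's (3.42) for the operator `ops.Gop` on the blocks of `𝔅`; ★ `ineq343_h1_of_GAZdOfOps` — the (3.43) clause of `B9.Ineq343_345` read likewise (both definitional).
* §4 non-negativity of every reading (real-`iSup` ∕ `sqrt` conventions): `supBlkZd_nonneg`, `eOfOps_nonneg`, `h1OfOps_nonneg`, `e4OfOps_nonneg`,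
  `h2OfOps_nonneg`, `l2OfOps_nonneg`.
* §5 sanity ∕ A6: at `Gop := 0` every reading is `0` (`eOfOps_gop_zero`, `h1OfOps_gop_zero`, `e4OfOps_gop_zero`, `h2OfOps_gop_zero`, `l2OfOps_gop_zero`,
  `glob2OfOps_gop_zero`; letters `cdBZd_zero`, `cdsBZd_zero`, `lapBZd_zero`, `cutMulZd_zero`, `supBlkZd_zero`, `holder0_zero`, `l2NormZd_zero`).

HONEST SCOPE.  (i) DEFINITIONS: `Gop` stays a letter (G(U₀) = (Ω₀Δ_aΩ₀)⁻¹ is the Thm 3.11 regime — N06's object-bound, not here); no estimate.  (ii) What it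
buys: `h33 : B9.Thm33Printed c35 (geoZd 𝔸 L len) (bgZd 𝔸 L) Gp (GAZdFamOfOps 𝔸 L len ops)` now quantifies print's (3.42)–(3.47) over the operator's own
local and global functionals, and edition δ's `HolderAtδ … (GAZdFamOfOps …) …` is a Lemma-2.1 summation statement (additivity of `Gop`, separation
`Sep22Zd`, finiteness caveats — to be displayed by whoever proves it).  (iii) A6: at `Gop := 0` every reading is `0`, so the hypothesis class stays
(trivially) inhabited — NOT content.  (iv) Junk conventions: real `iSup` (`0` for unbounded families), `l2NormZd` (`tsum`, `0` if not summable) — as in the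
frame.  (v) Count-neutral; N05 ∕ N06 NOT discharged; one finite lattice programme at fixed `ε`; R4 closes the conditional finite-𝕋⁴ rung `BalabanLadder.UV`
only; nothing continuum ∕ ℝ⁴ ∕ OS ∕ mass-gap ∕ Clay.  Unit `pub-ymgap-dag-n06-w2` (g0), 2026-08-27∕28.
-/

noncomputable section

namespace Literature.MathematicalPhysics.QuantumFieldTheory.Balaban1983to89.B9SupplySockB9P3ZdLocalLettersOfOps

open B7Prop2Explicit (unitaryUnits)
open B8Ineq132 (covDerivFwd covDeriv BondTouches)
open B8Eq140Level (SideTouches)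
open B8ScaledSupNorm (msup msup_nonneg)
open B8Eq138LandauZd (covLap)
open B8LeafModelZd (ZdIdx)
open B9Eq340HolderZd (hquot AdmPair holder0 hquot_nonneg)
open B9SupplySockB9P3ZdLetters (OpsZd)
open B9SupplySockB9P3ZdFrame (MemberZd BSite blockZd CfgZd geoZd LocalLettersZd GAZd GAZdFam globZd supNormZd l2NormZd cutSupZd cutHZd)

-- `Site` alone could resolve to the torus sites of `Setup.lean`; re-export the `ℤ^d` sites of `B7Prop1Explicit`.
export B7Prop1Explicit (Site)

variable {d : ℕ}

/-! ## §1 Letters on bond fields and the block supremum -/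

section Letters

variable {𝔸 : Type*}

/-- **`∇^η_{U,ν}` on a bond field, componentwise**: `(∇_{U,ν}J)_μ(z) = (D^η_{U,ν}J_μ)(z)` (B8 (1.1) ∕ [4] (3.3), `B8Ineq132.covDerivFwd` on each component
`J_μ`) — the `∇_U` of (3.42)∕(3.43). [cite: Balaban1985BackgroundPropagators, (3.3) p.390, (3.42) p.397; Balaban1985RegularSpaces, (1.1) p.76] -/
def cdBZd [NormedRing 𝔸] [NormedAlgebra ℂ 𝔸] (η : ℝ) (U : Site d → Fin d → 𝔸ˣ) (ν : Fin d) (J : Site d → Fin d → 𝔸) :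
    Site d → Fin d → 𝔸 :=
  fun z μ => covDerivFwd η U ν (fun w => J w μ) z

/-- **`∇^{η*}_{U,ν}` on a bond field, componentwise** (the backward covariant derivative (1.1), `B8Ineq132.covDeriv`) — the `∇*_U` of (3.42)∕(3.43).
[cite: Balaban1985BackgroundPropagators, (3.42) p.397; Balaban1985RegularSpaces, (1.1) p.76] -/
def cdsBZd [NormedRing 𝔸] [NormedAlgebra ℂ 𝔸] (η : ℝ) (U : Site d → Fin d → 𝔸ˣ) (ν : Fin d) (J : Site d → Fin d → 𝔸) :
    Site d → Fin d → 𝔸 :=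
  fun z μ => covDeriv η U ν (fun w => J w μ) z

/-- **`Δ^η_U` on a bond field, componentwise** (`B8Eq138LandauZd.covLap` on each component; dag-n05-a's reading (iv) of B8 (1.59), as in `globZd` n = 3).
[cite: Balaban1985BackgroundPropagators, (3.42) p.397; Balaban1985RegularSpaces, (1.59) p.86] -/
def lapBZd [NormedRing 𝔸] [NormedAlgebra ℂ 𝔸] (η : ℝ) (U : Site d → Fin d → 𝔸ˣ) (J : Site d → Fin d → 𝔸) :
    Site d → Fin d → 𝔸 :=
  fun z μ => covLap η U (fun w => J w μ) z

/-- **the cut-off «ζ·»** of (3.43) ∕ «h·» of (3.46): the real site function multiplies the bond field at the bond's base point.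
[cite: Balaban1985BackgroundPropagators, (3.43) + (3.46) p.398] -/
def cutMulZd [SMul ℂ 𝔸] (ζ : Site d → ℝ) (J : Site d → Fin d → 𝔸) : Site d → Fin d → 𝔸 :=
  fun z μ => ((ζ z : ℝ) : ℂ) • J z μ

/-- **«sup over x ∈ Δ(y)»** of (3.42): the supremum of `‖Ψ(b)‖` over the bonds touching the block `Δ(y) = blockZd L j y` of the coarse site `(j, y)`
(p. 77 bond convention — `geoZd`'s `suppIn`; real `iSup`, `0` for an unbounded family). [cite: Balaban1985BackgroundPropagators, (3.42) p.397 («for x ∈ Δ(y)»); Balaban1985RegularSpaces, p.77] -/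
def supBlkZd [Norm 𝔸] (L : ℕ) {x : MemberZd d L} (y : BSite L x) (Ψ : Site d → Fin d → 𝔸) : ℝ :=
  ⨆ b : {b : Site d × Fin d // BondTouches (blockZd L y.1.1 y.1.2) b.1 b.2}, ‖Ψ b.1.1 b.1.2‖

/-- the block supremum is non-negative. [cite: Balaban1985BackgroundPropagators, (3.42) p.397 (bookkeeping)] -/
theorem supBlkZd_nonneg [SeminormedAddCommGroup 𝔸] (L : ℕ) {x : MemberZd d L} (y : BSite L x) (Ψ : Site d → Fin d → 𝔸) :
    0 ≤ supBlkZd L y Ψ :=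
  Real.iSup_nonneg fun _ => norm_nonneg _

end Letters

/-! ## §2 The readings of a letter record at a member -/

section Readings

variable (𝔸 : Type) [CStarAlgebra 𝔸] (L : ℕ) (len : Site d → ℝ)

/-- **THE FOUR SUP ENTRIES (3.42) OF `G(U)`** at `(U, J, y)`: `sup_{x∈Δ(y)} ‖(GJ)(x)‖`, `max_ν sup ‖(∇_{U,ν}GJ)(x)‖`, `max_ν sup ‖(G∇*_{U,ν}J)(x)‖`,
`sup ‖(Δ_U GJ)(x)‖` (the prefactors `[(Lʲη)², Lʲη, Lʲη, 1]` are the schema's `pref4`, not folded in). [cite: Balaban1985BackgroundPropagators, (3.42) p.397, Thm 3.3 p.399] -/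
def eOfOps (ops : OpsZd d 𝔸) (x : MemberZd d L) (n : Fin 4) (U : CfgZd d 𝔸) (J : Site d → Fin d → 𝔸) (y : BSite L x) : ℝ :=
  (![supBlkZd L y (ops.Gop U.1 J),
      ⨆ ν : Fin d, supBlkZd L y (cdBZd x.i.η U.1 ν (ops.Gop U.1 J)),
      ⨆ ν : Fin d, supBlkZd L y (ops.Gop U.1 (cdsBZd x.i.η U.1 ν J)),
      supBlkZd L y (lapBZd x.i.η U.1 (ops.Gop U.1 J))] : Fin 4 → ℝ) n

/-- **THE HÖLDER ENTRY (3.43) OF `G(U)`** at `(U, J, β, ζ)`: the larger of `max_ν ‖ζ∇_{U,ν}G(U)J‖_β` and `max_ν ‖ζG(U)∇*_{U,ν}J‖_β`, the covariant Hölder norm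
(3.40) at the background `U` (`B9Eq340HolderZd.holder0 η β len U`). [cite: Balaban1985BackgroundPropagators, (3.43) p.398, (3.40) p.397] -/
def h1OfOps (ops : OpsZd d 𝔸) (x : MemberZd d L) (U : CfgZd d 𝔸) (J : Site d → Fin d → 𝔸) (β : ℝ) (ζ : Site d → ℝ) : ℝ :=
  max (⨆ ν : Fin d, holder0 x.i.η β len U.1 (cutMulZd ζ (cdBZd x.i.η U.1 ν (ops.Gop U.1 J))))
    (⨆ ν : Fin d, holder0 x.i.η β len U.1 (cutMulZd ζ (ops.Gop U.1 (cdsBZd x.i.η U.1 ν J))))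

/-- **THE ENTRY (3.44) OF `G(U)`** at `(U, J, y)`: `max_{ν,μ} sup_{x∈Δ(y)} ‖(∇_{U,ν}G(U)∇*_{U,μ}J)(x)‖`. [cite: Balaban1985BackgroundPropagators, (3.44) p.398] -/
def e4OfOps (ops : OpsZd d 𝔸) (x : MemberZd d L) (U : CfgZd d 𝔸) (J : Site d → Fin d → 𝔸) (y : BSite L x) : ℝ :=
  ⨆ ν : Fin d, ⨆ μ : Fin d, supBlkZd L y (cdBZd x.i.η U.1 ν (ops.Gop U.1 (cdsBZd x.i.η U.1 μ J)))

/-- **THE HÖLDER ENTRY (3.45) OF `G(U)`** at `(U, J, β, ζ)`: `max_{ν,μ} ‖ζ∇_{U,ν}G(U)∇*_{U,μ}J‖_β`. [cite: Balaban1985BackgroundPropagators, (3.45) p.398, (3.40) p.397] -/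
def h2OfOps (ops : OpsZd d 𝔸) (x : MemberZd d L) (U : CfgZd d 𝔸) (J : Site d → Fin d → 𝔸) (β : ℝ) (ζ : Site d → ℝ) : ℝ :=
  ⨆ ν : Fin d, ⨆ μ : Fin d, holder0 x.i.η β len U.1 (cutMulZd ζ (cdBZd x.i.η U.1 ν (ops.Gop U.1 (cdsBZd x.i.η U.1 μ J))))

/-- **THE SIX `L²` QUANTITIES (3.46) OF `G(U)`** with cut-off `h`: `‖hGJ‖, max_ν‖h∇_νGJ‖, max_ν‖hG∇*_νJ‖, max_{ν,μ}‖h∇_νG∇*_μJ‖, max_{ν,μ}‖h∇_ν∇_μGJ‖,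
max_{ν,μ}‖hG∇*_ν∇*_μJ‖` in the `η`-lattice `L²` norm (`l2NormZd`). [cite: Balaban1985BackgroundPropagators, (3.46) p.398] -/
def l2OfOps (ops : OpsZd d 𝔸) (x : MemberZd d L) (n : Fin 6) (U : CfgZd d 𝔸) (J : Site d → Fin d → 𝔸) (h : Site d → ℝ) : ℝ :=
  (![l2NormZd x.i.η (cutMulZd h (ops.Gop U.1 J)),
      ⨆ ν : Fin d, l2NormZd x.i.η (cutMulZd h (cdBZd x.i.η U.1 ν (ops.Gop U.1 J))),
      ⨆ ν : Fin d, l2NormZd x.i.η (cutMulZd h (ops.Gop U.1 (cdsBZd x.i.η U.1 ν J))),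
      ⨆ ν : Fin d, ⨆ μ : Fin d, l2NormZd x.i.η (cutMulZd h (cdBZd x.i.η U.1 ν (ops.Gop U.1 (cdsBZd x.i.η U.1 μ J)))),
      ⨆ ν : Fin d, ⨆ μ : Fin d, l2NormZd x.i.η (cutMulZd h (cdBZd x.i.η U.1 ν (cdBZd x.i.η U.1 μ (ops.Gop U.1 J)))),
      ⨆ ν : Fin d, ⨆ μ : Fin d, l2NormZd x.i.η (cutMulZd h (ops.Gop U.1 (cdsBZd x.i.η U.1 ν (cdsBZd x.i.η U.1 μ J))))] : Fin 6 → ℝ) n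

/-- **THE GLOBAL ENTRY n = 2 OF (3.47)**, `|G(U)∇*_Uλ|_{(1+γ)}`: the weighted sup (`msup` at exponent `1 + γ`) over the sides of the plaquettes of the `Ω_j`
of all `(G(U)∇*_{U,ν}J)_μ(z)` — the shape of `globZd`'s n = 1 entry with `G∇*` for `∇G` (the one global entry the frame left a letter).
[cite: Balaban1985BackgroundPropagators, (3.47) p.398] -/
def glob2OfOps (ops : OpsZd d 𝔸) (x : MemberZd d L) (U : CfgZd d 𝔸) (J : Site d → Fin d → 𝔸) (γ : ℝ) : ℝ :=
  msup L x.m x.i.η (1 + γ) (fun j (t : Fin d × Fin d × Site d) => SideTouches (x.i.Ω j) t.2.2 t.2.1)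
    (fun t => ops.Gop U.1 (cdsBZd x.i.η U.1 t.1 J) t.2.2 t.2.1)

/-- ★ **THE LOCAL LETTERS OF `G(U₀)` READ OFF THE OPERATOR** — the junction's `loc` of record (dag-n06-b (α)): n06-e's `LocalLettersZd 𝔸 L x` with every
field the corresponding (3.42)–(3.47) functional of `ops.Gop`. [cite: Balaban1985BackgroundPropagators, (3.42)–(3.47) pp.397–398, Thm 3.3 p.399] -/
def locOfOpsZd (ops : OpsZd d 𝔸) (x : MemberZd d L) : LocalLettersZd 𝔸 L x where
  e := eOfOps 𝔸 L ops x
  h1 := h1OfOps 𝔸 L len ops x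
  e4 := e4OfOps 𝔸 L ops x
  h2 := h2OfOps 𝔸 L len ops x
  l2 := l2OfOps 𝔸 L ops x
  glob2 := glob2OfOps 𝔸 L ops x

/-- **THE KERNEL FAMILY OF `G(U₀)` AT THE MEMBER WITH EVERY ENTRY READ OFF THE OPERATOR**: n06-e's `GAZd` at `loc := locOfOpsZd`.
[cite: Balaban1985BackgroundPropagators, Thm 3.3 p.399, (3.42)–(3.47) pp.397–398] -/
def GAZdOfOps (x : MemberZd d L) (ops : OpsZd d 𝔸) : B9.KernelFamily (geoZd 𝔸 L len x) (B9SupplySockB9P3ZdFrame.bgZd 𝔸 L x) :=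
  GAZd 𝔸 L len x ops (locOfOpsZd 𝔸 L len ops x)

/-- ★ **THE FAMILY OVER ALL MEMBERS** for a letter family `ops` — the `GA` slot of `B9.Thm33Printed c35 (geoZd 𝔸 L len) (bgZd 𝔸 L) Gp (GAZdFamOfOps 𝔸 L len ops)`,
N06's node sentence at the `ℤᵈ` instance ABOUT THE OPERATOR `G(U₀)`. [cite: Balaban1985BackgroundPropagators, Thm 3.3 p.399] -/
def GAZdFamOfOps (ops : ℝ → ZdIdx d L → ℕ → OpsZd d 𝔸) (x : MemberZd d L) :
    B9.KernelFamily (geoZd 𝔸 L len x) (B9SupplySockB9P3ZdFrame.bgZd 𝔸 L x) :=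
  GAZdOfOps 𝔸 L len x (ops x.M x.i x.m)

variable {𝔸 L len}

/-- `GAZdFamOfOps` IS n06-e's `GAZdFam` at `loc := fun x => locOfOpsZd … (ops x.M x.i x.m) x` — so every junction theorem stated over `GAZdFam … ops loc`
(`dictGlob_zd`, `sockB9P3_allLevels_of_thm33_zd`, …) applies verbatim. [cite: Balaban1985BackgroundPropagators, Thm 3.3 p.399 (bookkeeping)] -/
theorem GAZdFamOfOps_eq (ops : ℝ → ZdIdx d L → ℕ → OpsZd d 𝔸) :
    GAZdFamOfOps 𝔸 L len ops = GAZdFam 𝔸 L len ops (fun x => locOfOpsZd 𝔸 L len (ops x.M x.i x.m) x) := rfl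

/-! ## §3 What the kernel family now says: the readings unfolded -/

/-- the (3.42) entries of `GAZdOfOps` are `eOfOps`. [cite: Balaban1985BackgroundPropagators, (3.42) p.397] -/
theorem GAZdOfOps_e (x : MemberZd d L) (ops : OpsZd d 𝔸) : (GAZdOfOps 𝔸 L len x ops).e = eOfOps 𝔸 L ops x := rfl

/-- the (3.43) entry of `GAZdOfOps` is `h1OfOps`. [cite: Balaban1985BackgroundPropagators, (3.43) p.398] -/
theorem GAZdOfOps_h1 (x : MemberZd d L) (ops : OpsZd d 𝔸) : (GAZdOfOps 𝔸 L len x ops).h1 = h1OfOps 𝔸 L len ops x := rfl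

/-- the (3.44) entry of `GAZdOfOps` is `e4OfOps`. [cite: Balaban1985BackgroundPropagators, (3.44) p.398] -/
theorem GAZdOfOps_e4 (x : MemberZd d L) (ops : OpsZd d 𝔸) : (GAZdOfOps 𝔸 L len x ops).e4 = e4OfOps 𝔸 L ops x := rfl

/-- the (3.45) entry of `GAZdOfOps` is `h2OfOps`. [cite: Balaban1985BackgroundPropagators, (3.45) p.398] -/
theorem GAZdOfOps_h2 (x : MemberZd d L) (ops : OpsZd d 𝔸) : (GAZdOfOps 𝔸 L len x ops).h2 = h2OfOps 𝔸 L len ops x := rfl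

/-- the (3.46) entries of `GAZdOfOps` are `l2OfOps`. [cite: Balaban1985BackgroundPropagators, (3.46) p.398] -/
theorem GAZdOfOps_l2 (x : MemberZd d L) (ops : OpsZd d 𝔸) : (GAZdOfOps 𝔸 L len x ops).l2 = l2OfOps 𝔸 L ops x := rfl

/-- the (3.47) entries of `GAZdOfOps` are n06-e's `globZd` with `glob2 := glob2OfOps` (entries 0, 1, 3 untouched). [cite: Balaban1985BackgroundPropagators, (3.47) p.398] -/
theorem GAZdOfOps_glob (x : MemberZd d L) (ops : OpsZd d 𝔸) :
    (GAZdOfOps 𝔸 L len x ops).glob = globZd 𝔸 L x ops (glob2OfOps 𝔸 L ops x) := rfl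

/-- ★ **THE (3.42) CLAUSE OF `B9.Ineq342_346_347 (GAZdOfOps …) B₀ δ₀ U`, READ** — print's (3.42) for the operator `ops.Gop` on the blocks of `𝔅`:
for every entry `n`, every bond field `J` supported on the bonds of `Δ(y′)` and every block `y`,
`eOfOps n U J y ≤ B₀·[(Lʲη)², Lʲη, Lʲη, 1]_n·e^{−δ₀d(y,y′)}·|J|` (definitional unfolding). [cite: Balaban1985BackgroundPropagators, (3.42) p.397, Thm 3.3 p.399] -/
theorem ineq342_of_GAZdOfOps {x : MemberZd d L} {ops : OpsZd d 𝔸} {B₀ δ₀ : ℝ} {U : CfgZd d 𝔸}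
    (h : B9.Ineq342_346_347 (GAZdOfOps 𝔸 L len x ops) B₀ δ₀ U) (n : Fin 4) (J : Site d → Fin d → 𝔸) (y y' : BSite L x)
    (hJ : ∀ (z : Site d) (μ : Fin d), J z μ ≠ 0 → BondTouches (blockZd L y'.1.1 y'.1.2) z μ) :
    eOfOps 𝔸 L ops x n U J y ≤
      B₀ * B9.pref4 ((L : ℝ) ^ y.1.1 * x.i.η) n * Real.exp (-(δ₀ * B9SupplySockB9P3ZdFrame.distZd L x y y')) * supNormZd J :=
  h.1 n J y y' hJ

/-- ★ **THE (3.43) CLAUSE OF `B9.Ineq343_345 (GAZdOfOps …) Bβ Bε Bεβ δ₀ U`, READ** — print's (3.43) for the operator `ops.Gop`: for `0 ≤ β < 1`, a cut-off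
`ζ` supported in `Δ̃(y)` and `J` supported on the bonds of `Δ(y′)`, `h1OfOps U J β ζ ≤ Bβ(β)·(Lʲη)^{1−β}·(‖ζ‖_β + |ζ|)·e^{−δ₀d(y,y′)}·|J|` (definitional unfolding).
[cite: Balaban1985BackgroundPropagators, (3.43) p.398, Thm 3.3 p.399] -/
theorem ineq343_h1_of_GAZdOfOps {x : MemberZd d L} {ops : OpsZd d 𝔸} {Bβ Bε : ℝ → ℝ} {Bεβ : ℝ → ℝ → ℝ} {δ₀ : ℝ} {U : CfgZd d 𝔸}
    (h : B9.Ineq343_345 (GAZdOfOps 𝔸 L len x ops) Bβ Bε Bεβ δ₀ U) (β : ℝ) (J : Site d → Fin d → 𝔸) (ζ : Site d → ℝ) (y y' : BSite L x)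
    (hβ0 : 0 ≤ β) (hβ1 : β < 1) (hζ : ∀ z : Site d, ζ z ≠ 0 → z ∈ B9SupplySockB9P3ZdFrame.blockTZd L y.1.1 y.1.2)
    (hJ : ∀ (z : Site d) (μ : Fin d), J z μ ≠ 0 → BondTouches (blockZd L y'.1.1 y'.1.2) z μ) :
    h1OfOps 𝔸 L len ops x U J β ζ ≤
      Bβ β * ((L : ℝ) ^ y.1.1 * x.i.η) ^ (1 - β) * cutHZd x.i.η β len ζ *
        Real.exp (-(δ₀ * B9SupplySockB9P3ZdFrame.distZd L x y y')) * supNormZd J :=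
  h.1 β J ζ y y' hβ0 hβ1 hζ hJ

/-! ## §4 Non-negativity of the readings -/

/-- the (3.42) readings are non-negative. [cite: Balaban1985BackgroundPropagators, (3.42) p.397 (bookkeeping)] -/
theorem eOfOps_nonneg (ops : OpsZd d 𝔸) (x : MemberZd d L) (n : Fin 4) (U : CfgZd d 𝔸) (J : Site d → Fin d → 𝔸) (y : BSite L x) :
    0 ≤ eOfOps 𝔸 L ops x n U J y := by
  fin_cases n
  · exact supBlkZd_nonneg L y _
  · exact Real.iSup_nonneg fun _ => supBlkZd_nonneg L y _
  · exact Real.iSup_nonneg fun _ => supBlkZd_nonneg L y _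
  · exact supBlkZd_nonneg L y _

/-- the covariant Hölder norm (3.40) of any bond field is non-negative (`η ≥ 0`). [cite: Balaban1985BackgroundPropagators, (3.40) p.397 (bookkeeping)] -/
theorem holder0_nonneg {η : ℝ} (hη : 0 ≤ η) (β : ℝ) (len : Site d → ℝ) (U₀ : Site d → Fin d → 𝔸ˣ) (A : Site d → Fin d → 𝔸) :
    0 ≤ holder0 η β len U₀ A :=
  Real.iSup_nonneg fun q => hquot_nonneg hη β U₀ _ q.2.2

/-- the (3.43) reading is non-negative. [cite: Balaban1985BackgroundPropagators, (3.43) p.398 (bookkeeping)] -/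
theorem h1OfOps_nonneg (ops : OpsZd d 𝔸) (x : MemberZd d L) (U : CfgZd d 𝔸) (J : Site d → Fin d → 𝔸) (β : ℝ) (ζ : Site d → ℝ) :
    0 ≤ h1OfOps 𝔸 L len ops x U J β ζ :=
  le_max_of_le_left (Real.iSup_nonneg fun _ => holder0_nonneg x.i.hη.le β len _ _)

/-- the (3.44) reading is non-negative. [cite: Balaban1985BackgroundPropagators, (3.44) p.398 (bookkeeping)] -/
theorem e4OfOps_nonneg (ops : OpsZd d 𝔸) (x : MemberZd d L) (U : CfgZd d 𝔸) (J : Site d → Fin d → 𝔸) (y : BSite L x) :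
    0 ≤ e4OfOps 𝔸 L ops x U J y :=
  Real.iSup_nonneg fun _ => Real.iSup_nonneg fun _ => supBlkZd_nonneg L y _

/-- the (3.45) reading is non-negative. [cite: Balaban1985BackgroundPropagators, (3.45) p.398 (bookkeeping)] -/
theorem h2OfOps_nonneg (ops : OpsZd d 𝔸) (x : MemberZd d L) (U : CfgZd d 𝔸) (J : Site d → Fin d → 𝔸) (β : ℝ) (ζ : Site d → ℝ) :
    0 ≤ h2OfOps 𝔸 L len ops x U J β ζ :=
  Real.iSup_nonneg fun _ => Real.iSup_nonneg fun _ => holder0_nonneg x.i.hη.le β len _ _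

/-- the `η`-lattice `L²` norm is non-negative. [cite: Balaban1985BackgroundPropagators, (3.46) p.398 (bookkeeping)] -/
theorem l2NormZd_nonneg {E : Type*} [SeminormedAddCommGroup E] (η : ℝ) (J : Site d → Fin d → E) : 0 ≤ l2NormZd η J :=
  Real.sqrt_nonneg _

/-- the (3.46) readings are non-negative. [cite: Balaban1985BackgroundPropagators, (3.46) p.398 (bookkeeping)] -/
theorem l2OfOps_nonneg (ops : OpsZd d 𝔸) (x : MemberZd d L) (n : Fin 6) (U : CfgZd d 𝔸) (J : Site d → Fin d → 𝔸) (h : Site d → ℝ) :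
    0 ≤ l2OfOps 𝔸 L ops x n U J h := by
  fin_cases n
  · exact l2NormZd_nonneg _ _
  · exact Real.iSup_nonneg fun _ => l2NormZd_nonneg _ _
  · exact Real.iSup_nonneg fun _ => l2NormZd_nonneg _ _
  · exact Real.iSup_nonneg fun _ => Real.iSup_nonneg fun _ => l2NormZd_nonneg _ _
  · exact Real.iSup_nonneg fun _ => Real.iSup_nonneg fun _ => l2NormZd_nonneg _ _
  · exact Real.iSup_nonneg fun _ => Real.iSup_nonneg fun _ => l2NormZd_nonneg _ _

end Readings

/-! ## §5 Sanity ∕ A6: at the zero letter every reading vanishes (the trivial inhabitant — NOT content) -/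

section Zero

variable {𝔸 : Type} [CStarAlgebra 𝔸] {L : ℕ} {len : Site d → ℝ}

/-- `∇_{U,ν}` of the zero bond field is zero. [cite: Balaban1985RegularSpaces, (1.1) p.76 (bookkeeping)] -/
theorem cdBZd_zero (η : ℝ) (U : Site d → Fin d → 𝔸ˣ) (ν : Fin d) : cdBZd η U ν (0 : Site d → Fin d → 𝔸) = 0 := by
  funext z μ
  exact B8Eq138LandauZd.covDerivFwd_zero_fun (η := η) (U₀ := U) ν z

/-- `∇*_{U,ν}` of the zero bond field is zero. [cite: Balaban1985RegularSpaces, (1.1) p.76 (bookkeeping)] -/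
theorem cdsBZd_zero (η : ℝ) (U : Site d → Fin d → 𝔸ˣ) (ν : Fin d) : cdsBZd η U ν (0 : Site d → Fin d → 𝔸) = 0 := by
  funext z μ
  exact B8Eq138LandauZd.covDeriv_zero_fun (η := η) (U₀ := U) ν z

/-- `Δ_U` of the zero bond field is zero. [cite: Balaban1985RegularSpaces, (1.59) p.86 (bookkeeping)] -/
theorem lapBZd_zero (η : ℝ) (U : Site d → Fin d → 𝔸ˣ) : lapBZd η U (0 : Site d → Fin d → 𝔸) = 0 := by
  funext z μ
  exact B8Eq138LandauZd.covLap_zero (η := η) (U₀ := U) z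

/-- the cut-off of the zero field is zero. [cite: Balaban1985BackgroundPropagators, (3.43) p.398 (bookkeeping)] -/
theorem cutMulZd_zero (ζ : Site d → ℝ) : cutMulZd ζ (0 : Site d → Fin d → 𝔸) = 0 := by
  funext z μ
  simp [cutMulZd]

/-- the block supremum of the zero field is zero. [cite: Balaban1985BackgroundPropagators, (3.42) p.397 (bookkeeping)] -/
theorem supBlkZd_zero {x : MemberZd d L} (y : BSite L x) : supBlkZd L y (0 : Site d → Fin d → 𝔸) = 0 := by
  simp [supBlkZd]

/-- the covariant Hölder norm (3.40) of the zero field is zero. [cite: Balaban1985BackgroundPropagators, (3.40) p.397 (bookkeeping)] -/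
theorem holder0_zero (η β : ℝ) (len : Site d → ℝ) (U : Site d → Fin d → 𝔸ˣ) : holder0 η β len U (0 : Site d → Fin d → 𝔸) = 0 := by
  simp [holder0, hquot, B9Eq340HolderZd.trans, B7Eq78Linearization.conjR]

/-- the `L²` norm of the zero field is zero. [cite: Balaban1985BackgroundPropagators, (3.46) p.398 (bookkeeping)] -/
theorem l2NormZd_zero (η : ℝ) : l2NormZd η (0 : Site d → Fin d → 𝔸) = 0 := by
  simp [l2NormZd]

variable {ops : OpsZd d 𝔸} (hG : ∀ (U : Site d → Fin d → 𝔸ˣ) (J : Site d → Fin d → 𝔸), ops.Gop U J = 0)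
include hG

/-- at `Gop := 0` the (3.42) readings vanish. [cite: Balaban1985BackgroundPropagators, (3.42) p.397 (bookkeeping)] -/
theorem eOfOps_gop_zero (x : MemberZd d L) (n : Fin 4) (U : CfgZd d 𝔸) (J : Site d → Fin d → 𝔸) (y : BSite L x) :
    eOfOps 𝔸 L ops x n U J y = 0 := by
  fin_cases n <;> simp [eOfOps, hG, cdBZd_zero, lapBZd_zero, supBlkZd_zero]

/-- at `Gop := 0` the (3.43) reading vanishes. [cite: Balaban1985BackgroundPropagators, (3.43) p.398 (bookkeeping)] -/
theorem h1OfOps_gop_zero (x : MemberZd d L) (U : CfgZd d 𝔸) (J : Site d → Fin d → 𝔸) (β : ℝ) (ζ : Site d → ℝ) :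
    h1OfOps 𝔸 L len ops x U J β ζ = 0 := by
  simp [h1OfOps, hG, cdBZd_zero, cutMulZd_zero, holder0_zero]

/-- at `Gop := 0` the (3.44) reading vanishes. [cite: Balaban1985BackgroundPropagators, (3.44) p.398 (bookkeeping)] -/
theorem e4OfOps_gop_zero (x : MemberZd d L) (U : CfgZd d 𝔸) (J : Site d → Fin d → 𝔸) (y : BSite L x) :
    e4OfOps 𝔸 L ops x U J y = 0 := by
  simp [e4OfOps, hG, cdBZd_zero, supBlkZd_zero]

/-- at `Gop := 0` the (3.45) reading vanishes. [cite: Balaban1985BackgroundPropagators, (3.45) p.398 (bookkeeping)] -/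
theorem h2OfOps_gop_zero (x : MemberZd d L) (U : CfgZd d 𝔸) (J : Site d → Fin d → 𝔸) (β : ℝ) (ζ : Site d → ℝ) :
    h2OfOps 𝔸 L len ops x U J β ζ = 0 := by
  simp [h2OfOps, hG, cdBZd_zero, cutMulZd_zero, holder0_zero]

/-- at `Gop := 0` the (3.46) readings vanish. [cite: Balaban1985BackgroundPropagators, (3.46) p.398 (bookkeeping)] -/
theorem l2OfOps_gop_zero (x : MemberZd d L) (n : Fin 6) (U : CfgZd d 𝔸) (J : Site d → Fin d → 𝔸) (h : Site d → ℝ) :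
    l2OfOps 𝔸 L ops x n U J h = 0 := by
  fin_cases n <;> simp [l2OfOps, hG, cdBZd_zero, cutMulZd_zero, l2NormZd_zero]

/-- at `Gop := 0` the (3.47) n = 2 reading vanishes. [cite: Balaban1985BackgroundPropagators, (3.47) p.398 (bookkeeping)] -/
theorem glob2OfOps_gop_zero (x : MemberZd d L) (U : CfgZd d 𝔸) (J : Site d → Fin d → 𝔸) (γ : ℝ) :
    glob2OfOps 𝔸 L ops x U J γ = 0 := by
  simp [glob2OfOps, hG, msup]

end Zero

end Literature.MathematicalPhysics.QuantumFieldTheory.Balaban1983to89.B9SupplySockB9P3ZdLocalLettersOfOps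

end
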